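import Literature.Analysis.ValidatedNumerics.ParametricVertexCertificateInterval
import HarnessLib

/-!
# Interval pencil bundles: `m · xᵀKx ≤ xᵀWx` and `κ · xᵀx ≤ xᵀKx` on a box for ENCLOSED affine tables

Topic `Literature/Analysis/ValidatedNumerics`. Sequel of `ParametricVertexCertificateInterval.lean`
(interval vertex bundles `checkVertexBundleI`) and of the exact pencil bundles of
`ParametricVertexCertificate.lean` (`PencilBundle`, `pencilTabs`, `checkPencilBundle`): the S4 pencil
shape for a client whose stiffness / mass tables `W_h(p)`, `K_h(p)` come from quadrature or irrational
data and are only ENCLOSED. Data: two affine INTERVAL families — centres `W₀, W^{(k)}` with radii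
`ΔW₀, ΔW^{(k)}`, centres `K₀, K^{(k)}` with radii `ΔK₀, ΔK^{(k)}` (rational tables, radii `≥ 0`) — a box
`[lo, hi]`, a FIXED margin `m` and a definiteness margin `κ > 0`. At parameter `p` the family is every
pair of real matrices `(W, K)` with `|W − W(p)| ≤ ΔW(p)` and `|K − K(p)| ≤ ΔK(p)` entrywise, where
`W(p) = W₀ + Σ p_k W^{(k)}`, `ΔW(p) = ΔW₀ + Σ |p_k| ΔW^{(k)}` (and likewise for `K`).

The checker `checkPencilBundleI` runs `checkVertexBundleI` twice: on the interval affine family of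
`W − m·K` — centres `W₀ − mK₀`, `W^{(k)} − mK^{(k)}` (= `pencilTabs`), radii `ΔW₀ + |m|ΔK₀`,
`ΔW^{(k)} + |m|ΔK^{(k)}` (= `pencilRadTabs`) — with claim `≥ 0`, and on the interval family of `K` with
claim `≥ κ`. SOUNDNESS (`pencil_forms_interval_on_box_of_checkPencilBundleI`,
`le_pencil_rayleigh_interval_of_checkPencilBundleI`): for every `p` of the box and every member pair
`(W, K)` at `p`: `m·xᵀKx ≤ xᵀWx`, `κ·xᵀx ≤ xᵀKx` (all `x`), and for `x ≠ 0`, `xᵀKx > 0` and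
`m ≤ xᵀWx / xᵀKx` — every generalised eigenvalue of a symmetric-definite member pencil is `≥ m`. The one
step beyond the exact pencil bundle is the triangle inequality
`|(W − mK) − (W(p) − mK(p))| ≤ ΔW(p) + |m|ΔK(p)`, which places `W − mK` in the combined interval family;
everything else is `form_ge_interval_affine_of_checkVertexBundleI`.

A second section gives the composition lemmas for CHUNKED kernel checking of interval bundles (one
`decide` per corner; same pattern as `cornerOK` / `checkVertexBundle_of_parts` for exact bundles): no new
trust, the checkers' own defining equations.

## What is NOT certified

Radii tables must be entrywise `≥ 0` (checked); `m` is FIXED before the check (the generalised Rayleigh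
quotient is not concave in `p` when `K` varies, so `m` is not optimised by the vertices); non-affine
dependence; anything off the box; which member pair a client's true `(W_h, K_h)` is (the client's
enclosure claim); any relation between the pencil and a differential operator it discretises.

## References

* [Hladik2017] M. Hladík, arXiv:1704.05782 (2017), Thm. 7 (vertex property of linear parametric
  families) and §3 (parametric interval matrices); applied to `W − mK` and to `K`.
  [cite: Hladik2017, Thm. 7 and §3]
-/

open Finset Matrix

namespace Literature.Analysis.ValidatedNumerics

open ParametricIntervalPosSemidef ParametricEigenMargin

/-! ### Data and checker -/

/-- The table `A + |m|·B` (entrywise, exact): the radii of `W − m·K` from the radii of `W` and of `K`.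
[folklore] -/
def addAbsSmulTab (n : ℕ) (m : ℚ) (A B : List (List ℚ)) : List (List ℚ) :=
  mtab n n fun i j ↦ mget A i j + |m| * mget B i j

/-- Radii tables of the shifted pencil family `W − m·K`: `ΔW₀ + |m|ΔK₀` and, per parameter,
`ΔW^{(k)} + |m|ΔK^{(k)}`. [cite: Hladik2017, §3 (parametric interval matrix), applied to `W − mK`] -/
def pencilRadTabs (n K : ℕ) (m : ℚ) (DW0 : List (List ℚ)) (DWs : List (List (List ℚ)))
    (DK0 : List (List ℚ)) (DKs : List (List (List ℚ))) : List (List ℚ) × List (List (List ℚ)) :=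
  (addAbsSmulTab n m DW0 DK0, vtab K fun k ↦ addAbsSmulTab n m (DWs.getD k []) (DKs.getD k []))

/-- **The interval pencil-bundle checker**: `κ > 0`, the interval vertex bundle of `W − m·K` (centres
`pencilTabs`, radii `pencilRadTabs`) with claim `0` checks, and the interval vertex bundle of `K` with
claim `κ` checks. [cite: Hladik2017, Thm. 7 and §3, twice] -/
def checkPencilBundleI (n K : ℕ) (W0 : List (List ℚ)) (Ws : List (List (List ℚ)))
    (DW0 : List (List ℚ)) (DWs : List (List (List ℚ))) (K0 : List (List ℚ)) (Ks : List (List (List ℚ)))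
    (DK0 : List (List ℚ)) (DKs : List (List (List ℚ))) (lo hi : List ℚ) (b : PencilBundle) : Bool :=
  decide (0 < b.κ) &&
    checkVertexBundleI n K (pencilTabs n K b.m W0 Ws K0 Ks).1 (pencilTabs n K b.m W0 Ws K0 Ks).2
      (pencilRadTabs n K b.m DW0 DWs DK0 DKs).1 (pencilRadTabs n K b.m DW0 DWs DK0 DKs).2 lo hi
      ⟨0, b.certsW⟩ &&
    checkVertexBundleI n K K0 Ks DK0 DKs lo hi ⟨b.κ, b.certsK⟩

/-! ### Plumbing -/

/-- Entries of `finMat` (plumbing). [folklore] -/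
private theorem finMat_apply₃ (n : ℕ) (A : List (List ℚ)) (i j : Fin n) :
    finMat n A i j = mreal A i j := rfl

/-- `finMat (A − m·B) = finMat A − m • finMat B` (same statement as the private lemma of
`ParametricVertexCertificate.lean`). [folklore] -/
private theorem finMat_subSmulTab' (n : ℕ) (m : ℚ) (A B : List (List ℚ)) :
    finMat n (subSmulTab n m A B) = finMat n A - (m : ℝ) • finMat n B := by
  ext i j
  rw [Matrix.sub_apply, Matrix.smul_apply, finMat_apply₃, finMat_apply₃, finMat_apply₃, smul_eq_mul]
  unfold subSmulTab mreal
  rw [mget_mtab _ i.isLt j.isLt]; push_cast; ring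

/-- The real family of the shifted pencil tables is `W(p) − m·K(p)` (same statement as the private lemma
of `ParametricVertexCertificate.lean`). [folklore] -/
private theorem affine_pencilTabs_eq' {n K : ℕ} (m : ℚ) (W0 : List (List ℚ))
    (Ws : List (List (List ℚ))) (K0 : List (List ℚ)) (Ks : List (List (List ℚ))) (p : Fin K → ℝ) :
    finMat n (pencilTabs n K m W0 Ws K0 Ks).1
        + paramMatrix (fun k : Fin K ↦ finMat n ((pencilTabs n K m W0 Ws K0 Ks).2.getD k [])) p
      = (finMat n W0 + paramMatrix (fun k : Fin K ↦ finMat n (Ws.getD k [])) p)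
        - (m : ℝ) • (finMat n K0 + paramMatrix (fun k : Fin K ↦ finMat n (Ks.getD k [])) p) := by
  have h2 : ∀ k : Fin K, (pencilTabs n K m W0 Ws K0 Ks).2.getD k []
      = subSmulTab n m (Ws.getD k []) (Ks.getD k []) := fun k ↦ by
    show ((List.range K).map fun k ↦ subSmulTab n m (Ws.getD k []) (Ks.getD k [])).getD k [] = _
    rw [List.getD_eq_getElem (l := (List.range K).map _) (d := []) (by simp [k.isLt]),
      List.getElem_map, List.getElem_range]
  ext i j
  simp only [Matrix.add_apply, Matrix.sub_apply, Matrix.smul_apply, paramMatrix_apply, h2,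
    show (pencilTabs n K m W0 Ws K0 Ks).1 = subSmulTab n m W0 K0 from rfl, finMat_subSmulTab',
    smul_eq_mul, mul_sub]
  rw [Finset.sum_sub_distrib, mul_add, Finset.mul_sum]
  have e : ∑ x, p x * ((m : ℝ) * finMat n (Ks.getD x []) i j)
      = ∑ x, (m : ℝ) * (p x * finMat n (Ks.getD x []) i j) :=
    Finset.sum_congr rfl fun x _ ↦ by ring
  rw [e]; ring

/-- Real entries of `addAbsSmulTab`: `(A + |m|B) i j = A i j + |m|·B i j`. [folklore] -/
private theorem mreal_addAbsSmulTab {n : ℕ} (m : ℚ) (A B : List (List ℚ)) (i j : Fin n) :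
    mreal (addAbsSmulTab n m A B) i j = mreal A i j + |(m : ℝ)| * mreal B i j := by
  unfold addAbsSmulTab mreal
  rw [mget_mtab _ i.isLt j.isLt]; push_cast; rfl

/-- The `k`-th radii table of `pencilRadTabs`. [folklore] -/
private theorem pencilRadTabs_snd_getD {n K : ℕ} (m : ℚ) (DW0 : List (List ℚ))
    (DWs : List (List (List ℚ))) (DK0 : List (List ℚ)) (DKs : List (List (List ℚ))) (k : Fin K) :
    (pencilRadTabs n K m DW0 DWs DK0 DKs).2.getD k []
      = addAbsSmulTab n m (DWs.getD k []) (DKs.getD k []) := by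
  show ((List.range K).map fun k ↦ addAbsSmulTab n m (DWs.getD k []) (DKs.getD k [])).getD k [] = _
  rw [List.getD_eq_getElem (l := (List.range K).map _) (d := []) (by simp [k.isLt]),
    List.getElem_map, List.getElem_range]

/-- **The combined family**: if `|W − W(p)| ≤ ΔW(p)` and `|K − K(p)| ≤ ΔK(p)` entrywise then
`W − m·K` lies in the interval affine family with centres `pencilTabs` and radii `pencilRadTabs` at `p`
(triangle inequality). [cite: Hladik2017, §3 (parametric interval matrix), applied to `W − mK`] -/
private theorem sub_smul_mem_pencil_family {n K : ℕ} (m : ℚ) {W0 K0 DW0 DK0 : List (List ℚ)}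
    {Ws Ks DWs DKs : List (List (List ℚ))} {p : Fin K → ℝ} {Wm Km : Matrix (Fin n) (Fin n) ℝ}
    (hW : ∀ i j : Fin n,
      |Wm i j - (finMat n W0 + paramMatrix (fun k : Fin K ↦ finMat n (Ws.getD k [])) p) i j|
        ≤ mreal DW0 i j + ∑ k : Fin K, |p k| * mreal (DWs.getD k []) i j)
    (hK : ∀ i j : Fin n,
      |Km i j - (finMat n K0 + paramMatrix (fun k : Fin K ↦ finMat n (Ks.getD k [])) p) i j|
        ≤ mreal DK0 i j + ∑ k : Fin K, |p k| * mreal (DKs.getD k []) i j) (i j : Fin n) :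
    |(Wm - (m : ℝ) • Km) i j
        - (finMat n (pencilTabs n K m W0 Ws K0 Ks).1
            + paramMatrix (fun k : Fin K ↦ finMat n ((pencilTabs n K m W0 Ws K0 Ks).2.getD k [])) p) i j|
      ≤ mreal (pencilRadTabs n K m DW0 DWs DK0 DKs).1 i j
        + ∑ k : Fin K, |p k| * mreal ((pencilRadTabs n K m DW0 DWs DK0 DKs).2.getD k []) i j := by
  rw [affine_pencilTabs_eq']
  simp only [pencilRadTabs_snd_getD, show (pencilRadTabs n K m DW0 DWs DK0 DKs).1
    = addAbsSmulTab n m DW0 DK0 from rfl, mreal_addAbsSmulTab, Matrix.sub_apply, Matrix.smul_apply,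
    smul_eq_mul]
  set cW := (finMat n W0 + paramMatrix (fun k : Fin K ↦ finMat n (Ws.getD k [])) p) i j
  set cK := (finMat n K0 + paramMatrix (fun k : Fin K ↦ finMat n (Ks.getD k [])) p) i j
  have hsplit : (mreal DW0 i j + |(m : ℝ)| * mreal DK0 i j)
      + ∑ k : Fin K, |p k| * (mreal (DWs.getD k []) i j + |(m : ℝ)| * mreal (DKs.getD k []) i j)
      = (mreal DW0 i j + ∑ k : Fin K, |p k| * mreal (DWs.getD k []) i j)
        + |(m : ℝ)| * (mreal DK0 i j + ∑ k : Fin K, |p k| * mreal (DKs.getD k []) i j) := by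
    have e : ∀ k : Fin K, |p k| * (mreal (DWs.getD k []) i j + |(m : ℝ)| * mreal (DKs.getD k []) i j)
        = |p k| * mreal (DWs.getD k []) i j + |(m : ℝ)| * (|p k| * mreal (DKs.getD k []) i j) :=
      fun k ↦ by ring
    simp only [e, Finset.sum_add_distrib, ← Finset.mul_sum]
    ring
  rw [hsplit]
  have h1 : |(m : ℝ) * (Km i j - cK)| = |(m : ℝ)| * |Km i j - cK| := abs_mul _ _
  have h2 : |(m : ℝ)| * |Km i j - cK|
      ≤ |(m : ℝ)| * (mreal DK0 i j + ∑ k : Fin K, |p k| * mreal (DKs.getD k []) i j) :=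
    mul_le_mul_of_nonneg_left (hK i j) (abs_nonneg _)
  calc |Wm i j - (m : ℝ) * Km i j - (cW - (m : ℝ) * cK)|
      = |(Wm i j - cW) - (m : ℝ) * (Km i j - cK)| := by ring_nf
    _ ≤ |Wm i j - cW| + |(m : ℝ) * (Km i j - cK)| := abs_sub _ _
    _ ≤ _ := by rw [h1]; exact add_le_add (hW i j) h2

/-! ### Soundness -/

/-- **Pencil margin and definiteness on the whole box for ENCLOSED tables, from a kernel-checked interval
pencil bundle (END-TO-END).** If `checkPencilBundleI … = true` then for every `p` of the box, every `W`
with `|W − W(p)| ≤ ΔW(p)` and every `K` with `|K − K(p)| ≤ ΔK(p)` (entrywise), and every `x`: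
`m · xᵀKx ≤ xᵀWx` and `κ · xᵀx ≤ xᵀKx`. [cite: Hladik2017, Thm. 7 and §3, applied to `W − mK` and to `K`] -/
theorem pencil_forms_interval_on_box_of_checkPencilBundleI {n K : ℕ} {W0 K0 DW0 DK0 : List (List ℚ)}
    {Ws Ks DWs DKs : List (List (List ℚ))} {lo hi : List ℚ} {b : PencilBundle}
    (h : checkPencilBundleI n K W0 Ws DW0 DWs K0 Ks DK0 DKs lo hi b = true) {p : Fin K → ℝ}
    (hp : p ∈ Set.Icc (fun k : Fin K ↦ vreal lo k) (fun k : Fin K ↦ vreal hi k))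
    {Wm Km : Matrix (Fin n) (Fin n) ℝ}
    (hW : ∀ i j : Fin n,
      |Wm i j - (finMat n W0 + paramMatrix (fun k : Fin K ↦ finMat n (Ws.getD k [])) p) i j|
        ≤ mreal DW0 i j + ∑ k : Fin K, |p k| * mreal (DWs.getD k []) i j)
    (hK : ∀ i j : Fin n,
      |Km i j - (finMat n K0 + paramMatrix (fun k : Fin K ↦ finMat n (Ks.getD k [])) p) i j|
        ≤ mreal DK0 i j + ∑ k : Fin K, |p k| * mreal (DKs.getD k []) i j) (x : Fin n → ℝ) :
    (b.m : ℝ) * (x ⬝ᵥ Km *ᵥ x) ≤ x ⬝ᵥ Wm *ᵥ x ∧ (b.κ : ℝ) * (x ⬝ᵥ x) ≤ x ⬝ᵥ Km *ᵥ x := by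
  unfold checkPencilBundleI at h
  simp only [Bool.and_eq_true, decide_eq_true_eq] at h
  obtain ⟨⟨-, hWc⟩, hKc⟩ := h
  refine ⟨?_, form_ge_interval_affine_of_checkVertexBundleI hKc hp hK x⟩
  have h1 := form_ge_interval_affine_of_checkVertexBundleI hWc hp
    (sub_smul_mem_pencil_family b.m hW hK) x
  rw [Matrix.sub_mulVec, dotProduct_sub, Matrix.smul_mulVec, dotProduct_smul, smul_eq_mul] at h1
  push_cast at h1
  linarith

/-- **Generalised Rayleigh-quotient bound on the whole box for ENCLOSED tables**: `κ > 0` (checked) makes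
`xᵀKx > 0` for `x ≠ 0`, hence `m ≤ xᵀWx / xᵀKx` for every member pair at every `p` of the box — every
generalised eigenvalue of a symmetric-definite member pencil `(W, K)`, a stationary value of this
quotient, is `≥ m`. [cite: Hladik2017, Thm. 7 and §3, applied twice] -/
theorem le_pencil_rayleigh_interval_of_checkPencilBundleI {n K : ℕ} {W0 K0 DW0 DK0 : List (List ℚ)}
    {Ws Ks DWs DKs : List (List (List ℚ))} {lo hi : List ℚ} {b : PencilBundle}
    (h : checkPencilBundleI n K W0 Ws DW0 DWs K0 Ks DK0 DKs lo hi b = true) {p : Fin K → ℝ}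
    (hp : p ∈ Set.Icc (fun k : Fin K ↦ vreal lo k) (fun k : Fin K ↦ vreal hi k))
    {Wm Km : Matrix (Fin n) (Fin n) ℝ}
    (hW : ∀ i j : Fin n,
      |Wm i j - (finMat n W0 + paramMatrix (fun k : Fin K ↦ finMat n (Ws.getD k [])) p) i j|
        ≤ mreal DW0 i j + ∑ k : Fin K, |p k| * mreal (DWs.getD k []) i j)
    (hK : ∀ i j : Fin n,
      |Km i j - (finMat n K0 + paramMatrix (fun k : Fin K ↦ finMat n (Ks.getD k [])) p) i j|
        ≤ mreal DK0 i j + ∑ k : Fin K, |p k| * mreal (DKs.getD k []) i j)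
    {x : Fin n → ℝ} (hx : x ≠ 0) :
    0 < x ⬝ᵥ Km *ᵥ x ∧ (b.m : ℝ) ≤ (x ⬝ᵥ Wm *ᵥ x) / (x ⬝ᵥ Km *ᵥ x) := by
  obtain ⟨hWK, hKK⟩ := pencil_forms_interval_on_box_of_checkPencilBundleI h hp hW hK x
  have hκ : (0 : ℝ) < b.κ := by
    unfold checkPencilBundleI at h
    simp only [Bool.and_eq_true, decide_eq_true_eq] at h
    exact_mod_cast h.1.1
  have hxx : 0 < x ⬝ᵥ x := by
    obtain ⟨i, hi⟩ := Function.ne_iff.1 hx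
    exact Finset.sum_pos' (fun j _ ↦ mul_self_nonneg (x j)) ⟨i, Finset.mem_univ i, mul_self_pos.2 hi⟩
  have hKp : 0 < x ⬝ᵥ Km *ᵥ x := (mul_pos hκ hxx).trans_le hKK
  exact ⟨hKp, (le_div_iff₀ hKp).2 hWK⟩

/-- **Eigenvalue form of the definiteness leg**: every real symmetric member `K` at a point of the box has
all eigenvalues `≥ κ`. [cite: Hladik2017, Thm. 7 and §3] -/
theorem le_eigenvalues_K_interval_of_checkPencilBundleI {n K : ℕ} {W0 K0 DW0 DK0 : List (List ℚ)}
    {Ws Ks DWs DKs : List (List (List ℚ))} {lo hi : List ℚ} {b : PencilBundle}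
    (h : checkPencilBundleI n K W0 Ws DW0 DWs K0 Ks DK0 DKs lo hi b = true) {p : Fin K → ℝ}
    (hp : p ∈ Set.Icc (fun k : Fin K ↦ vreal lo k) (fun k : Fin K ↦ vreal hi k))
    {Km : Matrix (Fin n) (Fin n) ℝ} (hKm : Km.IsHermitian)
    (hK : ∀ i j : Fin n,
      |Km i j - (finMat n K0 + paramMatrix (fun k : Fin K ↦ finMat n (Ks.getD k [])) p) i j|
        ≤ mreal DK0 i j + ∑ k : Fin K, |p k| * mreal (DKs.getD k []) i j) (i : Fin n) :
    (b.κ : ℝ) ≤ hKm.eigenvalues i := by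
  unfold checkPencilBundleI at h
  simp only [Bool.and_eq_true, decide_eq_true_eq] at h
  exact le_eigenvalues_interval_affine_of_checkVertexBundleI h.2 hp hKm hK i

/-! ### Composition lemmas for CHUNKED kernel checking of interval bundles (one `decide` per corner)

Same device as `cornerOK` / `checkVertexBundle_of_parts` / `checkPencilBundle_of_parts` of
`ParametricVertexCertificate.lean`: an emitted source proves each corner check separately and assembles
`checkVertexBundleI … = true` / `checkPencilBundleI … = true` by the checkers' defining equations. -/

/-- The check of corner number `idx` of an interval bundle: claim `≥ lam` and `checkLower` on the interval
data `(C(v), R(v))` of that corner. [cite: Hladik2017, Thm. 7 (one vertex) and §3] -/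
def cornerOKI (n K : ℕ) (A0 : List (List ℚ)) (As : List (List (List ℚ))) (D0 : List (List ℚ))
    (Ds : List (List (List ℚ))) (lo hi : List ℚ) (b : VertexBundle) (idx : ℕ) : Bool :=
  decide (b.lam ≤ (b.certs.getD idx default).lam) &&
    checkLower n (affineAtQ n K A0 As ((corners lo hi K).getD idx []))
      (affineRadAtQ n K D0 Ds ((corners lo hi K).getD idx [])) (b.certs.getD idx default)

/-- **Assembling an interval vertex bundle from its parts**: the symmetry and radii-sign checks, the length
check `(corners lo hi K).length = L ≤ #certs`, and `rall L (cornerOKI …)` (built corner by corner with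
`KernelData.rall_succ`) give `checkVertexBundleI … = true`. [cite: Hladik2017, Thm. 7 and §3] -/
theorem checkVertexBundleI_of_parts {n K : ℕ} {A0 : List (List ℚ)} {As : List (List (List ℚ))}
    {D0 : List (List ℚ)} {Ds : List (List (List ℚ))} {lo hi : List ℚ} {b : VertexBundle} {L : ℕ}
    (hs : symmQ n A0 = true) (hss : rall K (fun k ↦ symmQ n (As.getD k [])) = true)
    (h0 : nonnegQ n D0 = true) (hds : rall K (fun k ↦ nonnegQ n (Ds.getD k [])) = true)
    (hL : (corners lo hi K).length = L) (hlen : L ≤ b.certs.length)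
    (hall : rall L (cornerOKI n K A0 As D0 Ds lo hi b) = true) :
    checkVertexBundleI n K A0 As D0 Ds lo hi b = true := by
  unfold checkVertexBundleI
  simp only [Bool.and_eq_true, decide_eq_true_eq]
  refine ⟨⟨⟨⟨⟨hs, hss⟩, h0⟩, hds⟩, hL ▸ hlen⟩, ?_⟩
  rw [hL]
  exact hall

/-- **Assembling an interval pencil bundle from its parts**: `κ > 0` and the two interval vertex-bundle
checks (each of which may itself be assembled with `checkVertexBundleI_of_parts`).
[cite: Hladik2017, Thm. 7 and §3, twice] -/
theorem checkPencilBundleI_of_parts {n K : ℕ} {W0 K0 DW0 DK0 : List (List ℚ)}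
    {Ws Ks DWs DKs : List (List (List ℚ))} {lo hi : List ℚ} {b : PencilBundle} (hκ : 0 < b.κ)
    (hW : checkVertexBundleI n K (pencilTabs n K b.m W0 Ws K0 Ks).1 (pencilTabs n K b.m W0 Ws K0 Ks).2
      (pencilRadTabs n K b.m DW0 DWs DK0 DKs).1 (pencilRadTabs n K b.m DW0 DWs DK0 DKs).2 lo hi
      ⟨0, b.certsW⟩ = true)
    (hK : checkVertexBundleI n K K0 Ks DK0 DKs lo hi ⟨b.κ, b.certsK⟩ = true) :
    checkPencilBundleI n K W0 Ws DW0 DWs K0 Ks DK0 DKs lo hi b = true := by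
  unfold checkPencilBundleI
  simp only [Bool.and_eq_true, decide_eq_true_eq]
  exact ⟨⟨hκ, hW⟩, hK⟩

/-! ### Kernel example -/

/-- Interval pencil: `W(p) = [[2, p], [p, 2]] ± 1/10`, `K = I ± 1/20` (entrywise, radii constant in
`p`) on `p ∈ [−1, 1]`, margin `m = 1/2`, `κ = 1/2`. The corner interval families of `W − K/2` are
`[[3/2, ∓1], [∓1, 3/2]] ± 1/8` (Gershgorin with claim `0`: `1 + 1/4 ≤ 3/2`), those of `K` are
`I ± 1/20` (claim `1/2`: `1/10 ≤ 1 − 1/2`). -/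
example : checkPencilBundleI 2 1 [[2, 0], [0, 2]] [[[0, 1], [1, 0]]] [[1/10, 1/10], [1/10, 1/10]]
    [[[0, 0], [0, 0]]] [[1, 0], [0, 1]] [[[0, 0], [0, 0]]] [[1/20, 1/20], [1/20, 1/20]] [[[0, 0], [0, 0]]]
    [-1] [1] ⟨1/2, 1/2, [⟨0, 0, [], []⟩, ⟨0, 0, [], []⟩], [⟨1/2, 0, [], []⟩, ⟨1/2, 0, [], []⟩]⟩ = true := by
  decide +kernel

end Literature.Analysis.ValidatedNumerics
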